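import Summits.Parity.GeneralizedHardyLittlewood.Theorems.LeeYangFibresFibrationLemmaAsymptoticsTerms
import HarnessLib

/-!
# Fibration lemma (`DimOne → GeneralizedHardyLittlewood`): the averaging error is `o(N^{d+1})`

Support file for the statement item `FibrationLemma : DimOne → GeneralizedHardyLittlewood`
(stmt-Parity-0822, shared; here for route `LeeYangFibres`, whose `Assembly` (stmt-Parity-14612)
composes through it). From part 10b (`avgError_le_of_large`:
`avgError(N, z(N)) ≤ K (1 + log log N)^{2t} N^{d+1} (1/log N + 1/√N)` for `N` large) and the two
elementary limits of part 10a (`exists_log_pow_le`, `exists_pow_le_exp_half`):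

* `avgError_zOf_le_eventually` — for every `ε > 0`, `avgError d t L N (zOf d N) ≤ ε N^{d+1}` for all
  `N ≥ N₀(d, t, L, ε)`.

References: B. Green, T. Tao, *Linear equations in primes*, Ann. of Math. 171 (2010), §1 (remark after
Conj. 1.2) [GreenTao2010]. No named facts are used.
-/

noncomputable section

open Finset

namespace Summit.Parity.GeneralizedHardyLittlewood.Theorems.FibrationGlue

open Literature.NumberTheory.Sieve

variable {d t : ℕ}

/-- `0 ≤ avgConst d t L`. [folklore] -/
theorem avgConst_nonneg (ht : 1 ≤ t) (d L : ℕ) : 0 ≤ avgConst d t L := by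
  unfold avgConst
  have h1 : 0 ≤ tailConst t := zero_le_one.trans (one_le_tailConst ht)
  positivity

/-- **The averaging error is `o(N^{d+1})`**: for `d, t, L ≥ 1` and `ε > 0` there is `N₀` with
`avgError d t L N (zOf d N) ≤ ε N^{d+1}` for all `N ≥ N₀` (from `avgError_le_of_large`:
`K u^{2t}/log N ≤ ε/2` once `log N` is large, `exists_log_pow_le`; `K u^{2t}/√N ≤ ε/2` once
`log N` is large, `u = 1 + log log N ≤ log N` and `exists_pow_le_exp_half`, `√N = e^{(log N)/2}`).
[cite: GreenTao2010, §1 (remark after Conj. 1.2)] -/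
theorem avgError_zOf_le_eventually (hd : 1 ≤ d) (ht : 1 ≤ t) {L : ℕ} (hL : 1 ≤ L) {ε : ℝ}
    (hε : 0 < ε) :
    ∃ N₀ : ℕ, ∀ N : ℕ, N₀ ≤ N → avgError d t L N (zOf d N) ≤ ε * (N : ℝ) ^ (d + 1) := by
  set A : ℝ := avgConst d t L with hA
  have hA0 : 0 ≤ A := avgConst_nonneg ht d L
  obtain ⟨y₀, hy₀⟩ := exists_log_pow_le (2 * t) A (half_pos hε)
  obtain ⟨y₁, hy₁⟩ := exists_pow_le_exp_half (2 * t) A (half_pos hε)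
  obtain ⟨M, hM⟩ : ∃ M : ℕ, Real.exp (max (max y₀ y₁) 1) ≤ M := exists_nat_ge _
  refine ⟨max (max 3 ((16 ^ d) ^ 2)) (max (2 * L * L * (d + 1)) M), fun N hN => ?_⟩
  have hN3 : 3 ≤ N := (le_max_left _ _).trans (le_of_max_le_left hN)
  have hN16 : (16 ^ d) ^ 2 ≤ N := (le_max_right _ _).trans (le_of_max_le_left hN)
  have hND : 2 * L * L * (d + 1) ≤ N := (le_max_left _ _).trans (le_of_max_le_right hN)
  have hNM : M ≤ N := (le_max_right _ _).trans (le_of_max_le_right hN)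
  have hn0 : (0 : ℝ) < N := by exact_mod_cast (show 0 < N by omega)
  set y : ℝ := Real.log N with hy
  have hlogN : max (max y₀ y₁) 1 ≤ y := by
    rw [hy, Real.le_log_iff_exp_le hn0]
    exact hM.trans (by exact_mod_cast hNM)
  have hy₀N : y₀ ≤ y := (le_max_left _ _).trans ((le_max_left _ _).trans hlogN)
  have hy₁N : y₁ ≤ y := (le_max_right _ _).trans ((le_max_left _ _).trans hlogN)
  have hy1 : 1 ≤ y := (le_max_right _ _).trans hlogN
  have hypos : 0 < y := by linarith
  have h := avgError_le_of_large hd ht hL hN3 hN16 hND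
  rw [← hA] at h
  -- first term: `A u^{2t} N^{d+1} / log N ≤ (ε/2) N^{d+1}`
  have h1 : A * (1 + Real.log y) ^ (2 * t) * ((N : ℝ) ^ (d + 1) / y) ≤ ε / 2 * (N : ℝ) ^ (d + 1) := by
    have key : A * (1 + Real.log y) ^ (2 * t) ≤ ε / 2 * y := hy₀ y hy₀N
    calc A * (1 + Real.log y) ^ (2 * t) * ((N : ℝ) ^ (d + 1) / y)
        = A * (1 + Real.log y) ^ (2 * t) / y * (N : ℝ) ^ (d + 1) := by
          field_simp
      _ ≤ ε / 2 * (N : ℝ) ^ (d + 1) := by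
          refine mul_le_mul_of_nonneg_right ?_ (by positivity)
          rwa [div_le_iff₀ hypos]
  -- second term: `A u^{2t} N^{d+1} / √N ≤ (ε/2) N^{d+1}`
  have h2 : A * (1 + Real.log y) ^ (2 * t) * ((N : ℝ) ^ (d + 1) / Real.sqrt N) ≤
      ε / 2 * (N : ℝ) ^ (d + 1) := by
    have hlogy0 : 0 ≤ Real.log y := Real.log_nonneg hy1
    have hlogy : 1 + Real.log y ≤ y := by
      have := Real.log_le_sub_one_of_pos hypos
      linarith
    have hpow : (1 + Real.log y) ^ (2 * t) ≤ y ^ (2 * t) :=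
      pow_le_pow_left₀ (by linarith) hlogy _
    have key : A * y ^ (2 * t) ≤ ε / 2 * Real.exp (y / 2) := hy₁ y hy₁N
    have hsqrt : Real.exp (y / 2) = Real.sqrt N := by
      rw [Real.sqrt_eq_rpow, Real.rpow_def_of_pos hn0, hy]
      ring_nf
    have hsqrt0 : 0 < Real.sqrt N := Real.sqrt_pos.mpr hn0
    rw [hsqrt] at key
    calc A * (1 + Real.log y) ^ (2 * t) * ((N : ℝ) ^ (d + 1) / Real.sqrt N)
        ≤ A * y ^ (2 * t) * ((N : ℝ) ^ (d + 1) / Real.sqrt N) := by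
          refine mul_le_mul_of_nonneg_right (mul_le_mul_of_nonneg_left hpow hA0) (by positivity)
      _ = A * y ^ (2 * t) / Real.sqrt N * (N : ℝ) ^ (d + 1) := by
          field_simp
      _ ≤ ε / 2 * (N : ℝ) ^ (d + 1) := by
          refine mul_le_mul_of_nonneg_right ?_ (by positivity)
          rwa [div_le_iff₀ hsqrt0]
  calc avgError d t L N (zOf d N)
      ≤ A * (1 + Real.log (Real.log N)) ^ (2 * t) *
          ((N : ℝ) ^ (d + 1) / Real.log N + (N : ℝ) ^ (d + 1) / Real.sqrt N) := h
    _ = A * (1 + Real.log y) ^ (2 * t) * ((N : ℝ) ^ (d + 1) / y) +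
          A * (1 + Real.log y) ^ (2 * t) * ((N : ℝ) ^ (d + 1) / Real.sqrt N) := by
        rw [hy]; ring
    _ ≤ ε / 2 * (N : ℝ) ^ (d + 1) + ε / 2 * (N : ℝ) ^ (d + 1) := add_le_add h1 h2
    _ = ε * (N : ℝ) ^ (d + 1) := by ring

end Summit.Parity.GeneralizedHardyLittlewood.Theorems.FibrationGlue
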